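import Literature.Computability.FineGrained.SatAlgorithmsRandDetProofs
import HarnessLib

/-!
# Schöning's random-walk algorithm for `k`-SAT, machine I: the input transducer

Topic `Literature/Computability/FineGrained`; machine half of the line of work `SchoeningCoin*`
towards the named fact `Literature.Computability.FineGrained.schoening` (Schöning, FOCS 1999,
Theorem: `k`-SAT ∈ BPTIME(`(2 - 2/k)^n · poly(L)`)). The machine of `KSATInBPExpTime` reads the
Boolean word `⟨encodeBool φ, r⟩ = boolPair (KCNF.encodeBool φ) r` (the formula, then the coins).
Its main part is a structured stack program over Mathlib's alphabet `Γ'` (`SymbolPrograms.lean`);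
this file provides the first stage of the pipeline, a finite-state transducer
(`Transducers.lean`: linear time, `FST.timeComputable_eval`) from `Bool` to `Γ'` laying out

  `inputW φ r = bits numVars ++ comma :: (formW φ ++ blank :: r.map bit)`,

where `formW φ` lists the clauses as `bra, literals, ket` and a literal as its *index bits, then its
polarity bit, then a comma* (`litW`; the order of the Boolean code, so that no buffering is
needed — the stack program reads a literal by collecting its bits reversed, the polarity ending on
top), and every coin becomes a `bit`.

The transducer is the nested `boolPair` parser of `SatAlgorithmsRandDetProofs.lean`
(`Transcode.plvl1–3`: a bit at nesting depth `d` of the input occurs `2^d` times in a row) with a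
new depth-`0` layer (`cstep`): on entering the sink phase (the separator closing the formula) it
emits `blank`, and in the sink phase it copies the coins — `Transcode.pdFST` drops them. The block
lemmas (`crun_*`) are those of `Transcode` with outputs relabelled by `Transcode.toΓ`, proved the
same way (`simp` on the transition tables); `cFST_eval_input` is the layout theorem.

## References

* U. Schöning, *A probabilistic algorithm for k-SAT and constraint satisfaction problems*, Proc.
  40th FOCS (1999) 410–414 (the algorithm whose machine this serves) [key `SchoeningFOCS1999`].
* S. Arora, B. Barak, *Computational Complexity: A Modern Approach*, CUP 2009, §0.1 (pairing
  `⟨x, y⟩` of bit strings), §1.3 (machine composition).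
* J. E. Hopcroft, J. D. Ullman, *Introduction to Automata Theory, Languages, and Computation*,
  Addison-Wesley 1979, §2.7 (Mealy machines / generalised sequential machines).
-/

namespace Literature.Computability.FineGrained.SchoeningCoin

open _root_.Computability Complexity Turing BruteForce Transcode

variable {k : ℕ}

/-! ### The layout -/

/-- The `Γ'`-word of a literal as laid out by the parser: index bits, polarity bit, comma. [folklore] -/
def litW (l : ℕ × Bool) : List Γ' := (encodeNat l.1).map Γ'.bit ++ [Γ'.bit l.2, Γ'.comma]

/-- The `Γ'`-word of a clause: `bra`, its literals, `ket`. [folklore] -/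
def clauseW (c : List (ℕ × Bool)) : List Γ' := Γ'.bra :: (c.flatMap litW ++ [Γ'.ket])

/-- The `Γ'`-word of the clause list of a `k`-CNF. [folklore] -/
def formW (φ : KCNF k) : List Γ' := φ.clauses.flatMap clauseW

/-- The whole layout: header bits, comma, the clauses, `blank`, the coins. [folklore] -/
def inputW (φ : KCNF k) (r : List Bool) : List Γ' :=
  (encodeNat φ.numVars).map Γ'.bit ++ Γ'.comma :: (formW φ ++ Γ'.blank :: r.map Γ'.bit)

/-- The formula word contains no `blank`. [folklore] -/
theorem blank_not_mem_formW (φ : KCNF k) : Γ'.blank ∉ formW φ := by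
  simp [formW, clauseW, litW]

/-! ### The transducer -/

/-- The depth-`0` layer with coins: in the sink phase copy the coin; otherwise parse as
`Transcode.plvl0`, relabelling the tokens by `toΓ` and emitting `blank` on entering the sink
phase. [folklore] -/
def cstep (s : BSt) (b : Bool) : BSt × List Γ' :=
  if s.ph = .sink then (s, [Γ'.bit b])
  else ((plvl0 s b).1,
    if (plvl0 s b).1.ph = .sink then [Γ'.blank] else (plvl0 s b).2.toList.map toΓ)

/-- **The input transducer** of the Schöning machine. [folklore] -/
def cFST : FST BSt Bool Γ' where
  init := bst .hdr
  step := cstep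
  front _ := []
  keep _ := true

/-- `maxEmit cFST ≤ 1`. [folklore] -/
theorem cFST_maxEmit_le : cFST.maxEmit ≤ 1 :=
  Finset.sup_le fun p _ => by
    rcases p with ⟨s, b⟩
    show (cstep s b).2.length ≤ 1
    unfold cstep
    split_ifs
    · simp
    · simp
    · cases (plvl0 s b).2 <;> simp

/-- The transduction is the body (no front). [folklore] -/
theorem cFST_eval (w : List Bool) : cFST.eval w = (cFST.run (bst .hdr) w).2 := by
  simp [FST.eval, cFST]

/-! ### Runs on the blocks of the input -/

section Runs

variable (w : List Bool)

/-- A `numVars` bit (four raw bits) is emitted as a header bit. [folklore] -/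
theorem crun_hdr_bit (x : Bool) :
    cFST.run (bst .hdr) (x :: x :: x :: x :: w) =
      ((cFST.run (bst .hdr) w).1, Γ'.bit x :: (cFST.run (bst .hdr) w).2) := by
  simp [cFST, cstep, plvl0, plvl1, bst, toΓ]

/-- The separator after `numVars` is emitted as the header comma. [folklore] -/
theorem crun_hdr_sep :
    cFST.run (bst .hdr) (false :: false :: true :: true :: w) =
      ((cFST.run (bst .cnt) w).1, Γ'.comma :: (cFST.run (bst .cnt) w).2) := by
  simp [cFST, cstep, plvl0, plvl1, bst, toΓ]

/-- A unary clause-count bit is skipped. [folklore] -/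
theorem crun_cnt_bit :
    cFST.run (bst .cnt) (true :: true :: true :: true :: w) = cFST.run (bst .cnt) w := by
  simp [cFST, cstep, plvl0, plvl1, bst]

/-- The separator after the clause count. [folklore] -/
theorem crun_cnt_sep :
    cFST.run (bst .cnt) (false :: false :: true :: true :: w) = cFST.run (bst .gap) w := by
  simp [cFST, cstep, plvl0, plvl1, bst]

/-- The first depth-2 bit of a clause opens it (`bra`). [folklore] -/
theorem crun_gap_open (x : Bool) :
    cFST.run (bst .gap) (x :: x :: x :: x :: w) =
      ((cFST.run ⟨.ccnt, none, none, some x, none⟩ w).1,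
        Γ'.bra :: (cFST.run ⟨.ccnt, none, none, some x, none⟩ w).2) := by
  simp [cFST, cstep, plvl0, plvl1, plvl2, bst, toΓ]

/-- First half of a pair in the literal count. [folklore] -/
theorem crun_ccnt_half (x : Bool) :
    cFST.run (bst .ccnt) (x :: x :: x :: x :: w) = cFST.run ⟨.ccnt, none, none, some x, none⟩ w := by
  simp [cFST, cstep, plvl0, plvl1, plvl2, bst]

/-- Second half of an equal pair in the literal count. [folklore] -/
theorem crun_ccnt_bit (x : Bool) :
    cFST.run ⟨.ccnt, none, none, some x, none⟩ (x :: x :: x :: x :: w) = cFST.run (bst .ccnt) w := by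
  simp [cFST, cstep, plvl0, plvl1, plvl2, bst]

/-- The separator after the literal count. [folklore] -/
theorem crun_ccnt_sep :
    cFST.run ⟨.ccnt, none, none, some false, none⟩ (true :: true :: true :: true :: w) =
      cFST.run (bst .lgap) w := by
  simp [cFST, cstep, plvl0, plvl1, plvl2, bst]

/-- The first depth-3 bit of a literal opens it. [folklore] -/
theorem crun_lgap_half (x : Bool) :
    cFST.run (bst .lgap) (x :: x :: x :: x :: x :: x :: x :: x :: w) =
      cFST.run ⟨.idx, none, none, none, some x⟩ w := by
  simp [cFST, cstep, plvl0, plvl1, plvl2, plvl3, bst]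

/-- First half of a pair in the index. [folklore] -/
theorem crun_idx_half (x : Bool) :
    cFST.run (bst .idx) (x :: x :: x :: x :: x :: x :: x :: x :: w) =
      cFST.run ⟨.idx, none, none, none, some x⟩ w := by
  simp [cFST, cstep, plvl0, plvl1, plvl2, plvl3, bst]

/-- Second half of an equal pair in the index: an index bit is emitted. [folklore] -/
theorem crun_idx_bit (x : Bool) :
    cFST.run ⟨.idx, none, none, none, some x⟩ (x :: x :: x :: x :: x :: x :: x :: x :: w) =
      ((cFST.run (bst .idx) w).1, Γ'.bit x :: (cFST.run (bst .idx) w).2) := by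
  simp [cFST, cstep, plvl0, plvl1, plvl2, plvl3, bst, toΓ]

/-- The separator after the index. [folklore] -/
theorem crun_idx_sep :
    cFST.run ⟨.idx, none, none, none, some false⟩
        (true :: true :: true :: true :: true :: true :: true :: true :: w) = cFST.run (bst .pol) w := by
  simp [cFST, cstep, plvl0, plvl1, plvl2, plvl3, bst]

/-- The polarity bit is emitted as a bit. [folklore] -/
theorem crun_pol (p : Bool) :
    cFST.run (bst .pol) (p :: p :: p :: p :: p :: p :: p :: p :: w) =
      ((cFST.run (bst .ldone) w).1, Γ'.bit p :: (cFST.run (bst .ldone) w).2) := by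
  simp [cFST, cstep, plvl0, plvl1, plvl2, plvl3, bst, toΓ]

/-- First half of the separator after a literal. [folklore] -/
theorem crun_ldone_half :
    cFST.run (bst .ldone) (false :: false :: false :: false :: w) =
      cFST.run ⟨.ldone, none, none, some false, none⟩ w := by
  simp [cFST, cstep, plvl0, plvl1, plvl2, bst]

/-- Second half of the separator after a literal: the literal's comma is emitted. [folklore] -/
theorem crun_ldone_sep :
    cFST.run ⟨.ldone, none, none, some false, none⟩ (true :: true :: true :: true :: w) =
      ((cFST.run (bst .lgap) w).1, Γ'.comma :: (cFST.run (bst .lgap) w).2) := by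
  simp [cFST, cstep, plvl0, plvl1, plvl2, bst, toΓ]

/-- The separator after a clause closes it (`ket`). [folklore] -/
theorem crun_lgap_close :
    cFST.run (bst .lgap) (false :: false :: true :: true :: w) =
      ((cFST.run (bst .gap) w).1, Γ'.ket :: (cFST.run (bst .gap) w).2) := by
  simp [cFST, cstep, plvl0, plvl1, bst, toΓ]

/-- The separator after the formula: `blank` is emitted and the sink phase entered. [folklore] -/
theorem crun_gap_end :
    cFST.run (bst .gap) (false :: true :: w) =
      ((cFST.run (bst .sink) w).1, Γ'.blank :: (cFST.run (bst .sink) w).2) := by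
  simp [cFST, cstep, plvl0, bst]

/-- In the sink phase the coins are copied. [folklore] -/
theorem crun_sink : cFST.run (bst .sink) w = (bst .sink, w.map Γ'.bit) := by
  induction w with
  | nil => rfl
  | cons b w ih =>
    rw [FST.run_cons, show cFST.step (bst .sink) b = (bst .sink, [Γ'.bit b]) by simp [cFST, cstep, bst], ih]
    rfl

/-! ### Runs on numerals, literals, clauses -/

/-- The `numVars` header is emitted bit by bit. [folklore] -/
theorem crun_hdr_bits (bs : List Bool) :
    cFST.run (bst .hdr) (blow 4 bs ++ w) =
      ((cFST.run (bst .hdr) w).1, bs.map Γ'.bit ++ (cFST.run (bst .hdr) w).2) := by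
  induction bs with
  | nil => simp
  | cons b bs ih =>
    rw [blow_cons, List.append_assoc, replicate_four_append, crun_hdr_bit, ih]
    simp

/-- The unary clause count is skipped. [folklore] -/
theorem crun_cnt_bits (m : ℕ) :
    cFST.run (bst .cnt) (List.replicate (4 * m) true ++ w) = cFST.run (bst .cnt) w := by
  induction m with
  | zero => rfl
  | succ m ih =>
    rw [show 4 * (m + 1) = 4 + 4 * m by ring, List.replicate_add, List.append_assoc]
    exact (crun_cnt_bit _).trans ih

/-- Inside the literal count: the remaining unary bits, then the first half of the next pair. [folklore] -/
theorem crun_ccnt_bits (m : ℕ) (x : Bool) :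
    cFST.run (bst .ccnt) (List.replicate (8 * m) true ++ (List.replicate 4 x ++ w)) =
      cFST.run ⟨.ccnt, none, none, some x, none⟩ w := by
  induction m with
  | zero => exact crun_ccnt_half w x
  | succ m ih =>
    rw [show 8 * (m + 1) = 4 + (4 + 8 * m) by ring, List.replicate_add, List.replicate_add,
      List.append_assoc, List.append_assoc]
    exact ((crun_ccnt_half _ true).trans (crun_ccnt_bit _ true)).trans ih

/-- A clause header: `bra` is emitted, the unary literal count is skipped. [folklore] -/
theorem crun_gap_header (m : ℕ) (x : Bool) :
    cFST.run (bst .gap) (List.replicate (8 * m) true ++ (List.replicate 4 x ++ w)) =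
      ((cFST.run ⟨.ccnt, none, none, some x, none⟩ w).1,
        Γ'.bra :: (cFST.run ⟨.ccnt, none, none, some x, none⟩ w).2) := by
  cases m with
  | zero => exact crun_gap_open w x
  | succ m =>
    rw [show 8 * (m + 1) = 4 + (4 + 8 * m) by ring, List.replicate_add, List.replicate_add,
      List.append_assoc, List.append_assoc]
    change cFST.run (bst .gap) (true :: true :: true :: true :: (true :: true :: true :: true ::
      (List.replicate (8 * m) true ++ (List.replicate 4 x ++ w)))) = _
    rw [crun_gap_open, crun_ccnt_bit, crun_ccnt_bits]

/-- Inside the index: the remaining index bits are emitted, then the first half of the next pair.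
[folklore] -/
theorem crun_idx_bits (bs : List Bool) (x : Bool) :
    cFST.run (bst .idx) (blow 16 bs ++ (List.replicate 8 x ++ w)) =
      ((cFST.run ⟨.idx, none, none, none, some x⟩ w).1,
        bs.map Γ'.bit ++ (cFST.run ⟨.idx, none, none, none, some x⟩ w).2) := by
  induction bs with
  | nil => exact crun_idx_half w x
  | cons b bs ih =>
    rw [blow_cons, List.append_assoc]
    change cFST.run (bst .idx) (b :: b :: b :: b :: b :: b :: b :: b ::
      (b :: b :: b :: b :: b :: b :: b :: b :: (blow 16 bs ++ (List.replicate 8 x ++ w)))) = _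
    rw [crun_idx_half, crun_idx_bit, ih]
    simp

/-- A literal's index from between literals: the index bits, then the first half of the next pair.
[folklore] -/
theorem crun_lgap_bits (bs : List Bool) (x : Bool) :
    cFST.run (bst .lgap) (blow 16 bs ++ (List.replicate 8 x ++ w)) =
      ((cFST.run ⟨.idx, none, none, none, some x⟩ w).1,
        bs.map Γ'.bit ++ (cFST.run ⟨.idx, none, none, none, some x⟩ w).2) := by
  cases bs with
  | nil => exact crun_lgap_half w x
  | cons b bs =>
    rw [blow_cons, List.append_assoc]
    change cFST.run (bst .lgap) (b :: b :: b :: b :: b :: b :: b :: b ::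
      (b :: b :: b :: b :: b :: b :: b :: b :: (blow 16 bs ++ (List.replicate 8 x ++ w)))) = _
    rw [crun_lgap_half, crun_idx_bit, crun_idx_bits]
    simp

/-- **A literal.** [folklore] -/
theorem crun_lgap_lit (l : ℕ × Bool) :
    cFST.run (bst .lgap) (rawLit l ++ w) =
      ((cFST.run (bst .lgap) w).1, litW l ++ (cFST.run (bst .lgap) w).2) := by
  simp only [rawLit, List.append_assoc]
  rw [crun_lgap_bits, replicate_eight_append, crun_idx_sep, replicate_eight_append, crun_pol,
    replicate_four_append, crun_ldone_half, replicate_four_append, crun_ldone_sep]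
  simp [litW]

/-- The literals of a clause. [folklore] -/
theorem crun_lgap_lits (c : List (ℕ × Bool)) :
    cFST.run (bst .lgap) (c.flatMap rawLit ++ w) =
      ((cFST.run (bst .lgap) w).1, c.flatMap litW ++ (cFST.run (bst .lgap) w).2) := by
  induction c with
  | nil => simp
  | cons l c ih => rw [List.flatMap_cons, List.append_assoc, crun_lgap_lit, ih]; simp

/-- **A clause.** [folklore] -/
theorem crun_gap_clause (c : List (ℕ × Bool)) :
    cFST.run (bst .gap) (rawClause c ++ w) =
      ((cFST.run (bst .gap) w).1, clauseW c ++ (cFST.run (bst .gap) w).2) := by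
  simp only [rawClause, List.append_assoc]
  rw [crun_gap_header, replicate_four_append, crun_ccnt_sep, crun_lgap_lits]
  simp only [List.cons_append, List.nil_append]
  rw [crun_lgap_close]
  simp [clauseW]

/-- The clauses. [folklore] -/
theorem crun_gap_clauses (cs : List (List (ℕ × Bool))) :
    cFST.run (bst .gap) (cs.flatMap rawClause ++ w) =
      ((cFST.run (bst .gap) w).1, cs.flatMap clauseW ++ (cFST.run (bst .gap) w).2) := by
  induction cs with
  | nil => simp
  | cons c cs ih => rw [List.flatMap_cons, List.append_assoc, crun_gap_clause, ih]; simp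

end Runs

/-- **The transducer on the machine's input**: the layout `inputW φ r`. [folklore] -/
theorem cFST_run_input (φ : KCNF k) (r : List Bool) :
    cFST.run (bst .hdr) (boolPair φ.encodeBool r) = (bst .sink, inputW φ r) := by
  rw [boolPair_encodeBool, crun_hdr_bits, crun_hdr_sep, crun_cnt_bits, crun_cnt_sep, crun_gap_clauses,
    crun_gap_end, crun_sink]
  simp [inputW, formW]

/-- **The layout theorem**: `cFST.eval ⟨encodeBool φ, r⟩ = inputW φ r`. [folklore] -/
theorem cFST_eval_input (φ : KCNF k) (r : List Bool) :
    cFST.eval (boolPair φ.encodeBool r) = inputW φ r := by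
  rw [cFST_eval, cFST_run_input]

/-- The layout is shorter than the input. [folklore] -/
theorem length_cFST_eval_le (w : List Bool) : (cFST.eval w).length ≤ w.length := by
  rw [cFST_eval]
  have := cFST.length_run_le (bst .hdr) w
  have h1 := Nat.mul_le_mul_right w.length cFST_maxEmit_le
  omega

/-- **The input stage as a machine**: some `TM2` machine maps `⟨encodeBool φ, r⟩` to `inputW φ r`
within `2 · |⟨encodeBool φ, r⟩| + 3` steps. [folklore] -/
theorem exists_inputStage :
    ∃ M : TM2ComputableAux Bool Γ', ∀ (k : ℕ) (φ : KCNF k) (r : List Bool),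
      M.OutputsWithin (boolPair φ.encodeBool r) (inputW φ r) (2 * (boolPair φ.encodeBool r).length + 3) := by
  obtain ⟨M, hM⟩ := cFST.timeComputable_eval
  refine ⟨M, fun k φ r => ?_⟩
  have H := hM (boolPair φ.encodeBool r)
  change M.OutputsWithin (boolPair φ.encodeBool r) (cFST.eval (boolPair φ.encodeBool r))
    ((cFST.maxEmit + 1) * (boolPair φ.encodeBool r).length + 3) at H
  rw [cFST_eval_input] at H
  refine H.mono ?_
  have := Nat.mul_le_mul_right (boolPair φ.encodeBool r).length (Nat.add_le_add_right cFST_maxEmit_le 1)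
  omega

/-! ### The output stage -/

/-- The output transducer: every `bit b` becomes `b`, other symbols are dropped. [folklore] -/
def outFST : FST Unit Γ' Bool where
  init := ()
  step _ a := ((), match a with | Γ'.bit b => [b] | _ => [])
  front _ := []
  keep _ := true

/-- `maxEmit outFST ≤ 1`. [folklore] -/
theorem outFST_maxEmit_le : outFST.maxEmit ≤ 1 :=
  Finset.sup_le fun p _ => by
    rcases p with ⟨u, a⟩
    show (outFST.step u a).2.length ≤ 1
    cases a <;> simp [outFST]

/-- The output transducer on an answer bit. [folklore] -/
theorem outFST_eval_bit (b : Bool) : outFST.eval [Γ'.bit b] = [b] := by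
  simp [FST.eval, outFST, FST.run]

/-- **The output stage as a machine**: `[bit b] ↦ [b] = encodeBool b` within `5` steps. [folklore] -/
theorem exists_outputStage :
    ∃ M : TM2ComputableAux Γ' Bool, ∀ b : Bool, M.OutputsWithin [Γ'.bit b] (encodeBool b) 5 := by
  obtain ⟨M, hM⟩ := outFST.timeComputable_eval
  refine ⟨M, fun b => ?_⟩
  have H := hM [Γ'.bit b]
  change M.OutputsWithin [Γ'.bit b] (outFST.eval [Γ'.bit b]) ((outFST.maxEmit + 1) * [Γ'.bit b].length + 3) at H
  rw [outFST_eval_bit] at H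
  refine H.mono ?_
  have := outFST_maxEmit_le
  simp only [List.length_singleton, mul_one]
  omega

end Literature.Computability.FineGrained.SchoeningCoin
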